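import Literature.Probability.RandomPlanarGeometry.HexSAWPolygonCellsBoundary
import HarnessLib

/-!
# Cell calculus for honeycomb polygon surgery, XVIII: the six CORNERS of a hexagon, its boundary arcs as brick-wall paths, and the three
# hexagons at a corner

Topic `Literature/Probability/RandomPlanarGeometry` (lane «pcv-sawmu», a-p4 g22; sequel of `HexSAWPolygonCellsBoundary.lean` (XVII: `bond`, `bdry`)).

Second module of the BRIDGE between the cell layer of «OMEGA» and the tree's bond-set polygons.  For a hexagon `c = (x, y)` (brick
`[x, x+2] × [y, y+1]`) the corners `corner c 0 … corner c 5` are `(x,y), (x+1,y), (x+2,y), (x+2,y+1), (x+1,y+1), (x,y+1)` (indices mod `6`) and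
the neighbour in direction `i`, `nbrDir c i`, runs through `LL, LR, R, UR, UL, L` — so that ★ `bond_nbrDir : bond c (nbrDir c i) = s(corner c i, corner c (i+1))`:
the boundary hexagon of `c` is the closed walk `corner c 0 → corner c 1 → ⋯ → corner c 6 = corner c 0` and consecutive corners are adjacent in the brick
wall (`adj_corner_succ`).  `arcWalk hc a m` is the walk `corner c a → ⋯ → corner c (a+m)` along `m` consecutive bonds; it has length `m`, the expected
support and edge list, and is a PATH for `m ≤ 5` (`isPath_arcWalk`).  Finally ★ `cells_at_corner`: a hexagon `u` (brick) having `corner c i` as an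
endpoint of one of its bonds is `c`, `nbrDir c (i+5)` or `nbrDir c i` — three hexagons meet at every vertex of the honeycomb lattice.  These are the
inputs of the polygon-surgery lemmas of the sequel (`IsPolygon.reroute` applied to `bdry S` and the two complementary arcs of a hexagon).

Sources: N. Madras, G. Slade, *The Self-Avoiding Walk* (1993), §3.2, Definition 3.2.1 p. 62 and the proof of Theorem 3.2.3 (replace the part of the
polygon on a unit cell by the complementary part of the cell's boundary) [MadrasSlade1993]; I. G. Enting, I. Jensen, LNP 775 (2009) §7.4.2, Fig. 7.10
(brickwork form of the honeycomb lattice) [EntingJensen2009]; I. Jensen, J. Phys.: Conf. Ser. 42 (2006) 163 [Jensen2006HoneycombPolygons].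
Label (lane): LANE INFRASTRUCTURE; nothing new in writing.
-/

open Finset Literature.Probability.LatticeModels

namespace Literature.Probability.RandomPlanarGeometry.SAW

namespace HexCell

/-! ### Corners and directions -/

/-- The corners of the hexagon `c`, counter-clockwise from the lower-left one, indices mod `6`.
[cite: EntingJensen2009, §7.4.2, Fig. 7.10] -/
def corner (c : Cell) (i : ℕ) : Site 2 :=
  match i % 6 with
  | 0 => ![c.1, c.2]
  | 1 => ![c.1 + 1, c.2]
  | 2 => ![c.1 + 2, c.2]
  | 3 => ![c.1 + 2, c.2 + 1]
  | 4 => ![c.1 + 1, c.2 + 1]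
  | _ => ![c.1, c.2 + 1]

/-- The neighbour of `c` across the bond `corner c i – corner c (i+1)`: `LL, LR, R, UR, UL, L` for `i ≡ 0, …, 5`.
[cite: Jensen2006HoneycombPolygons, §2] -/
def nbrDir (c : Cell) (i : ℕ) : Cell :=
  match i % 6 with
  | 0 => LL c
  | 1 => LR c
  | 2 => R c
  | 3 => UR c
  | 4 => UL c
  | _ => L c

/-- `corner` only depends on the index mod `6`. [cite: EntingJensen2009, §7.4.2] -/
theorem corner_eq_of_mod_eq (c : Cell) {i j : ℕ} (h : i % 6 = j % 6) : corner c i = corner c j := by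
  unfold corner; rw [h]

/-- `nbrDir` only depends on the index mod `6`. [cite: Jensen2006HoneycombPolygons, §2] -/
theorem nbrDir_eq_of_mod_eq (c : Cell) {i j : ℕ} (h : i % 6 = j % 6) : nbrDir c i = nbrDir c j := by
  unfold nbrDir; rw [h]

/-- Periodicity of the corners. [cite: EntingJensen2009, §7.4.2] -/
theorem corner_add_six (c : Cell) (i : ℕ) : corner c (i + 6) = corner c i :=
  corner_eq_of_mod_eq c (by omega)

/-- Periodicity of the directions. [cite: Jensen2006HoneycombPolygons, §2] -/
theorem nbrDir_add_six (c : Cell) (i : ℕ) : nbrDir c (i + 6) = nbrDir c i :=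
  nbrDir_eq_of_mod_eq c (by omega)

/-- Every direction is a neighbour. [cite: Jensen2006HoneycombPolygons, §2] -/
theorem nbrDir_mem_nbrs (c : Cell) (i : ℕ) : nbrDir c i ∈ nbrs c := by
  unfold nbrDir
  split <;> simp [nbrs]

/-- `c` is a neighbour of each of its neighbours `nbrDir c i`. [cite: Jensen2006HoneycombPolygons, §2] -/
theorem self_mem_nbrs_nbrDir (c : Cell) (i : ℕ) : c ∈ nbrs (nbrDir c i) :=
  mem_nbrs_comm.1 (nbrDir_mem_nbrs c i)

/-- Six consecutive directions from any start enumerate all the neighbours. [cite: Jensen2006HoneycombPolygons, §2] -/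
theorem mem_nbrs_iff_exists_nbrDir {c d : Cell} (a : ℕ) : d ∈ nbrs c ↔ ∃ i < 6, d = nbrDir c (a + i) := by
  constructor
  · intro hd
    -- `d = nbrDir c r` for some `r < 6`, and `r ≡ a + i` for `i = (r + 6 - a % 6) % 6`
    have key : ∀ r < 6, d = nbrDir c r → ∃ i < 6, d = nbrDir c (a + i) := by
      intro r hr e
      refine ⟨(r + 6 - a % 6) % 6, Nat.mod_lt _ (by norm_num), ?_⟩
      rw [e]; exact nbrDir_eq_of_mod_eq c (by omega)
    obtain ⟨x, y⟩ := c
    simp only [mem_nbrs_iff] at hd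
    rcases hd with rfl | rfl | rfl | rfl | rfl | rfl
    · exact key 0 (by norm_num) (by simp [nbrDir, LL])
    · exact key 1 (by norm_num) (by simp [nbrDir, LR])
    · exact key 2 (by norm_num) (by simp [nbrDir, R])
    · exact key 3 (by norm_num) (by simp [nbrDir, UR])
    · exact key 4 (by norm_num) (by simp [nbrDir, UL])
    · exact key 5 (by norm_num) (by simp [nbrDir, L])
  · rintro ⟨i, -, rfl⟩; exact nbrDir_mem_nbrs c _

/-- Directions are distinct mod `6`. [cite: Jensen2006HoneycombPolygons, §2] -/
theorem nbrDir_injective_mod {c : Cell} {i j : ℕ} (h : nbrDir c i = nbrDir c j) : i % 6 = j % 6 := by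
  obtain ⟨x, y⟩ := c
  have hi := Nat.mod_lt i (show 0 < 6 by norm_num)
  have hj := Nat.mod_lt j (show 0 < 6 by norm_num)
  unfold nbrDir at h
  interval_cases hri : i % 6 <;> interval_cases hrj : j % 6 <;>
    simp_all [LL, LR, R, UR, UL, L, Prod.ext_iff] <;> omega

/-- Corners are distinct mod `6`. [cite: EntingJensen2009, §7.4.2] -/
theorem corner_injective_mod {c : Cell} {i j : ℕ} (h : corner c i = corner c j) : i % 6 = j % 6 := by
  obtain ⟨x, y⟩ := c
  have hi := Nat.mod_lt i (show 0 < 6 by norm_num)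
  have hj := Nat.mod_lt j (show 0 < 6 by norm_num)
  unfold corner at h
  interval_cases hri : i % 6 <;> interval_cases hrj : j % 6 <;>
    simp_all

/-- ★ The bond across direction `i` joins the corners `i` and `i+1`. [cite: EntingJensen2009, §7.4.2, Fig. 7.10] -/
theorem bond_nbrDir (c : Cell) (i : ℕ) : bond c (nbrDir c i) = s(corner c i, corner c (i + 1)) := by
  obtain ⟨x, y⟩ := c
  have hi := Nat.mod_lt i (show 0 < 6 by norm_num)
  unfold nbrDir corner
  interval_cases hri : i % 6
  · rw [show (i + 1) % 6 = 1 by omega]; simp [LL, bond_ll, hbond]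
  · rw [show (i + 1) % 6 = 2 by omega]; simp [LR, bond_lr, hbond, show x + 1 + 1 = x + 2 by ring]
  · rw [show (i + 1) % 6 = 3 by omega]; simp [R, bond_r, vbond]
  · rw [show (i + 1) % 6 = 4 by omega]; simp [UR, bond_ur, hbond, Sym2.eq_swap, show x + 1 + 1 = x + 2 by ring]
  · rw [show (i + 1) % 6 = 5 by omega]; simp [UL, bond_ul, hbond, Sym2.eq_swap]
  · rw [show (i + 1) % 6 = 0 by omega]; simp [L, bond_l, vbond, Sym2.eq_swap]

/-- Consecutive corners of a brick are adjacent in the brick wall. [cite: EntingJensen2009, §7.4.2, Fig. 7.10] -/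
theorem adj_corner_succ {c : Cell} (hc : Even (c.1 + c.2)) (i : ℕ) : brickWallGraph.Adj (corner c i) (corner c (i + 1)) := by
  rw [← SimpleGraph.mem_edgeSet, ← bond_nbrDir]
  exact bond_mem_edgeSet hc (nbrDir_mem_nbrs c i)

/-! ### Boundary arcs of a hexagon as walks -/

/-- The walk `corner c a → corner c (a+1) → ⋯ → corner c (a+m)` along the boundary of the brick `c`.
[cite: MadrasSlade1993, §3.2 (proof of Theorem 3.2.3: the part of the unit cell's boundary used by the surgery)] -/
def arcWalk {c : Cell} (hc : Even (c.1 + c.2)) (a : ℕ) : (m : ℕ) → brickWallGraph.Walk (corner c a) (corner c (a + m))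
  | 0 => SimpleGraph.Walk.nil
  | m + 1 => (arcWalk hc a m).concat (adj_corner_succ hc (a + m))

/-- `arcWalk` has length `m`. [cite: MadrasSlade1993, §3.2 (proof of Theorem 3.2.3)] -/
theorem length_arcWalk {c : Cell} (hc : Even (c.1 + c.2)) (a m : ℕ) : (arcWalk hc a m).length = m := by
  induction m with
  | zero => rfl
  | succ m ih => rw [arcWalk, SimpleGraph.Walk.length_concat, ih]

/-- The vertices of `arcWalk`. [cite: MadrasSlade1993, §3.2 (proof of Theorem 3.2.3)] -/
theorem support_arcWalk {c : Cell} (hc : Even (c.1 + c.2)) (a m : ℕ) :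
    (arcWalk hc a m).support = (List.range (m + 1)).map fun j => corner c (a + j) := by
  induction m with
  | zero => rfl
  | succ m ih =>
    rw [arcWalk, SimpleGraph.Walk.support_concat, ih, List.range_succ (n := m + 1), List.map_append, List.map_singleton]

/-- The bonds of `arcWalk`. [cite: MadrasSlade1993, §3.2 (proof of Theorem 3.2.3)] -/
theorem edges_arcWalk {c : Cell} (hc : Even (c.1 + c.2)) (a m : ℕ) :
    (arcWalk hc a m).edges = (List.range m).map fun j => bond c (nbrDir c (a + j)) := by
  induction m with
  | zero => rfl
  | succ m ih =>
    rw [arcWalk, SimpleGraph.Walk.edges_concat, ih, List.range_succ, List.map_append, List.map_singleton, List.concat_eq_append,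
      bond_nbrDir, Nat.add_assoc]

/-- Membership in the support of `arcWalk`. [cite: MadrasSlade1993, §3.2 (proof of Theorem 3.2.3)] -/
theorem mem_support_arcWalk {c : Cell} (hc : Even (c.1 + c.2)) {a m : ℕ} {x : Site 2} :
    x ∈ (arcWalk hc a m).support ↔ ∃ j ≤ m, x = corner c (a + j) := by
  rw [support_arcWalk, List.mem_map]
  constructor
  · rintro ⟨j, hj, rfl⟩; exact ⟨j, by simpa [List.mem_range, Nat.lt_succ_iff] using hj, rfl⟩
  · rintro ⟨j, hj, rfl⟩; exact ⟨j, by simpa [List.mem_range, Nat.lt_succ_iff] using hj, rfl⟩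

/-- Membership in the edge list of `arcWalk`. [cite: MadrasSlade1993, §3.2 (proof of Theorem 3.2.3)] -/
theorem mem_edges_arcWalk {c : Cell} (hc : Even (c.1 + c.2)) {a m : ℕ} {e : Sym2 (Site 2)} :
    e ∈ (arcWalk hc a m).edges ↔ ∃ j < m, e = bond c (nbrDir c (a + j)) := by
  rw [edges_arcWalk, List.mem_map]
  constructor
  · rintro ⟨j, hj, rfl⟩; exact ⟨j, by simpa [List.mem_range] using hj, rfl⟩
  · rintro ⟨j, hj, rfl⟩; exact ⟨j, by simpa [List.mem_range] using hj, rfl⟩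

/-- The edge set of `arcWalk` as an image. [cite: MadrasSlade1993, §3.2 (proof of Theorem 3.2.3)] -/
theorem edges_arcWalk_toFinset {c : Cell} (hc : Even (c.1 + c.2)) (a m : ℕ) :
    (arcWalk hc a m).edges.toFinset = (range m).image fun j => bond c (nbrDir c (a + j)) := by
  ext e
  rw [List.mem_toFinset, mem_edges_arcWalk hc, mem_image]
  constructor
  · rintro ⟨j, hj, rfl⟩; exact ⟨j, mem_range.2 hj, rfl⟩
  · rintro ⟨j, hj, rfl⟩; exact ⟨j, mem_range.1 hj, rfl⟩

/-- An arc of at most five bonds is a path (its corners are distinct). [cite: MadrasSlade1993, §3.2 (proof of Theorem 3.2.3)] -/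
theorem isPath_arcWalk {c : Cell} (hc : Even (c.1 + c.2)) (a : ℕ) {m : ℕ} (hm : m ≤ 5) : (arcWalk hc a m).IsPath := by
  rw [SimpleGraph.Walk.isPath_def, support_arcWalk]
  refine List.Nodup.map_on ?_ List.nodup_range
  intro j hj j' hj' h
  rw [List.mem_range] at hj hj'
  have := corner_injective_mod h
  omega

/-! ### The three hexagons at a corner -/

/-- ★ **Three hexagons meet at a corner**: if a bond of the hexagon `u` (a brick) has `corner c i` (of the brick `c`) as an endpoint, then `u` is `c`
or one of the two neighbours of `c` adjacent across the bonds at that corner, `nbrDir c (i + 5)` and `nbrDir c i`.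
[cite: EntingJensen2009, §7.4.2, Fig. 7.10 (the honeycomb lattice is trivalent: three hexagons at each vertex)] -/
theorem cells_at_corner {c u w : Cell} (hc : Even (c.1 + c.2)) (hu : Even (u.1 + u.2)) (hw : w ∈ nbrs u) {i : ℕ}
    (hi : corner c i ∈ bond u w) : u = c ∨ u = nbrDir c (i + 5) ∨ u = nbrDir c i := by
  obtain ⟨x, y⟩ := c
  obtain ⟨p, q⟩ := u
  obtain ⟨n, hn⟩ := hc
  obtain ⟨n', hn'⟩ := hu
  simp only at hn hn'
  have hi6 := Nat.mod_lt i (show 0 < 6 by norm_num)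
  unfold corner at hi
  unfold nbrDir
  simp only [mem_nbrs_iff] at hw
  interval_cases hri : i % 6 <;>
    (rw [show (i + 5) % 6 = ((i % 6) + 5) % 6 by omega, hri];
     rcases hw with rfl | rfl | rfl | rfl | rfl | rfl <;>
      simp only [bond_ll, bond_lr, bond_r, bond_ur, bond_ul, bond_l, hbond, vbond, Sym2.mem_iff, bwVec_eq_iff,
        LL, LR, R, UR, UL, L, Prod.mk.injEq, Nat.reduceMod, Nat.reduceAdd] at hi ⊢ <;>
      omega)

end HexCell

end Literature.Probability.RandomPlanarGeometry.SAW
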